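/-
Copyright (c) 2026 the pub-hodgecm-mathlib formalisation cell (harness21).  Prover seat hodgecm-mathlib-LH3-p02 (g5): line LH3 (closer stub `stub_N9`), LETTER L3′ SURJ-OF-FORWARD,
organ (Σ-WALL) — FILTRATION ROAD (W-ROAD CENSUS v1 6129001bfae4ccc0, RULING #26), brick (W3-G) part 2b: the GENERATORS at a central block.
-/
import Literature.NumberTheory.Rogawski1990.ArchRankOneWallSplitReading          -- ★ p851579 (this seat), (W3-G) part 1: `exists_splitReading_contDiff_even` (the smooth even split reading, the cone functional `Λ`)
import Literature.NumberTheory.Rogawski1990.ArchRankOneWallClassFunction         -- ★ (this seat), (W3-G) part 2a: `exists_contDiff_comp_trace_mul_eq_of_even`, `chartOrbHLoc_sub_traceMul_eq`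
import Literature.NumberTheory.Automorphic.ArchRankOneCasimirLadderCayley        -- ★ `exists_two_sin_smul_orbitalIntegral_cayley_eq` (Cayley frame of `U(Φ₂)_w` ↔ diagonal frame `U(σ_w diag(2,−2))`)
import Literature.NumberTheory.Automorphic.ArchRankOneLimitFormulaGroupSigned     -- ★ (R1G) signed `exists_tendsto_deriv_two_sin_smul_orbitalIntegral_neg` (Harish-Chandra's limit formula, `C < 0`)
import HarnessLib

/-!
# (W3-G), PART 2b: THE SPLIT-TYPE AND THE COMPACT-TYPE GENERATORS AT A CENTRAL BLOCK `z·1 ∈ U(Φ₂)_w` (Varadarajan 1989 §6.4 Thm 22/23; Rogawski 1990 §8.2; Shelstad 1979 Lemma 4.3)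

Topic `NumberTheory/Rogawski1990`; namespace `Literature.NumberTheory.Rogawski1990`.  THEOREMS ONLY (no `def`, no instance, no notation, no axiom, no named fact, no `sorry`).
Cell `pub/hodgecm-mathlib`, crux H413 (`stmt-HodgeConjecture-24833`), F0∕P3c line LH3 (closer stub `stub_N9`), LETTER L3′ SURJ-OF-FORWARD, organ (Σ-WALL) = `hwall` of ★
`bouazizSurjOfForward_of_reg_wall`, FILTRATION ROAD (W-ROAD CENSUS v1, LH3-p01 (g6); RULING #26): brick **(W3-G)** part 2b — the two rank-one GENERATORS the (W3-asm) package
(F0P3a-p08 (g24)) tensors over the places: at a wall place read SPLIT (`w ∈ T`) the SPLIT-TYPE generator `F¹` (a non-negative ambient bump at the centre: its normalised split reading is a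
smooth even `G` with `G(0, θ₀) ≠ 0`, ★ part 1), and at a wall place read COMPACT (`w ∈ Z ∖ T`) the COMPACT-TYPE generator `f^cp = F¹ − (ρ ∘ tr)·F¹κ` whose split readings VANISH near
the wall ((G1-w): `ρ` is the smooth CLASS function realising the ratio of the two even split readings — ★ part 2a) while its compact reading keeps Harish-Chandra's non-zero
`∂_ψ`-limit `C·f^cp(z·1) = C < 0` ((G3-w): ★ (R1G) signed, transported to the Cayley frame of `U(Φ₂)_w` by ★ `exists_two_sin_smul_orbitalIntegral_cayley_eq`).  Count-neutral.

WHAT IS PROVED: **`exists_splitType_wallGenerator`** (head 2 of the sigfirst) and **`exists_compactType_wallGenerator`** (head 3: (G1-w) + (G3-w)); helpers `exists_ambientBump_ofReal`,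
`exists_circleExp_eq_abs_sub_lt`.
HONEST LABEL: HC_CM is proved only modulo the 7 printed citations (2 remaining: hLiu418 = `stmt-HodgeConjecture-24832`, h413 = `stmt-HodgeConjecture-24833`) until rung 0 closes;
rank-one analysis over the ★ kit, pays nothing by itself.

## References
* [Varadarajan1989] V. S. Varadarajan, *An Introduction to Harmonic Analysis on Semisimple Lie Groups*, Cambridge Stud. Adv. Math. 16 (1989), §6.4 Lemma 21, Thm 22, Thm 23.
* [Rogawski1990] J. D. Rogawski, *Automorphic Representations of Unitary Groups in Three Variables*, Ann. of Math. Stud. 123 (1990), §8.2 Prop. 8.2.1 p. 119, pp. 122–123.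
* [Shelstad1979] D. Shelstad, *Characters and inner forms of a quasi-split group over ℝ*, Compositio Math. 39 (1979), Lemma 4.3 p. 25.
-/

set_option autoImplicit false

noncomputable section

open MeasureTheory MeasureTheory.Measure Set Filter Topology NumberField NumberField.InfinitePlace Complex Function
open scoped ENNReal NNReal ComplexConjugate Real MatrixGroups Matrix ContDiff Matrix.Norms.Operator

namespace Literature.NumberTheory.Rogawski1990

open Literature.NumberTheory.Automorphic Literature.NumberTheory.Automorphic.UnitaryGroup Literature.MeasureTheory.Group
open Literature.NumberTheory.Automorphic.UnitaryGroup.LineRing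

/-! ## §3 The two generators at a central block -/

section Generators

variable (L : Type) [Field L] [NumberField L] [IsCMField L] (w : {w : InfinitePlace L // IsComplex w})
  [MeasurableSpace ↥(archLocal L 2 (Matrix.of fun i j : Fin 2 => if i.val + j.val + 1 = 2 then (1 : L) else 0) w)]
  [BorelSpace ↥(archLocal L 2 (Matrix.of fun i j : Fin 2 => if i.val + j.val + 1 = 2 then (1 : L) else 0) w)]
  (νw : Measure ↥(archLocal L 2 (Matrix.of fun i j : Fin 2 => if i.val + j.val + 1 = 2 then (1 : L) else 0) w)) [νw.IsHaarMeasure] [νw.IsMulRightInvariant]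

/-- An ambient real bump, read `ℂ`-valued: smooth, compactly supported inside a prescribed neighbourhood, real non-negative, `= 1` at the centre (Mathlib `exists_contDiff_tsupport_subset`
on the finite-dimensional real space `M₂(ℂ)`). [cite: Varadarajan1989, §6.4 p. 229] -/
theorem exists_ambientBump_ofReal (X₀ : Matrix (Fin 2) (Fin 2) ℂ) {U : Set (Matrix (Fin 2) (Fin 2) ℂ)} (hU : U ∈ 𝓝 X₀) :
    ∃ b : Matrix (Fin 2) (Fin 2) ℂ → ℝ, ContDiff ℝ ∞ b ∧ HasCompactSupport b ∧ tsupport b ⊆ U ∧ (∀ X, 0 ≤ b X) ∧ b X₀ = 1 := by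
  obtain ⟨b, hbU, hbc, hbs, hb01, hb1⟩ := exists_contDiff_tsupport_subset (n := ⊤) hU
  exact ⟨b, hbs, hbc, hbU, fun X => (hb01 ⟨X, rfl⟩).1, hb1⟩

/-- **(W3-G, SPLIT-TYPE GENERATOR) at the central block `e^{iθ₀}·1`**: inside any prescribed neighbourhood `U` of `e^{iθ₀}·1` there is an ambient bump `f₀ ∈ C_c^∞(M₂(ℂ))`, real
non-negative, `= 1` at the centre, whose normalised split reading `G` (smooth, even in `x`, ★ part 1) does NOT vanish at `(0, θ₀)` ((G3-w′): the cone value at the vertex).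
[cite: Varadarajan1989, §6.4 Thm 23] [cite: Rogawski1990, §8.2 p. 122] -/
theorem exists_splitType_wallGenerator (θ₀ : ℝ) {U : Set (Matrix (Fin 2) (Fin 2) ℂ)} (hU : U ∈ 𝓝 ((((Circle.exp θ₀ : Circle) : ℂ)) • (1 : Matrix (Fin 2) (Fin 2) ℂ))) :
    ∃ (f₀ : Matrix (Fin 2) (Fin 2) ℂ → ℂ) (G : ℝ × ℝ → ℂ), ContDiff ℝ ∞ f₀ ∧ HasCompactSupport f₀ ∧ tsupport f₀ ⊆ U ∧ (∀ X, 0 ≤ (f₀ X).re ∧ (f₀ X).im = 0) ∧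
      f₀ ((((Circle.exp θ₀ : Circle) : ℂ)) • 1) = 1 ∧ ContDiff ℝ ∞ G ∧ (∀ x θ, G (-x, θ) = G (x, θ)) ∧ G (0, θ₀) ≠ 0 ∧
      ∀ S : Finset {w : InfinitePlace L // IsComplex w}, w ∈ S → ∀ cw : Fin 3 → ℝ, cw 0 ≠ 0 →
        (((|Real.exp (cw 0) - Real.exp (-(cw 0))| : ℝ) : ℂ) * chartOrbHLoc L S w νw (fun g => f₀ ((g : GL (Fin 2) ℂ) : Matrix (Fin 2) (Fin 2) ℂ)) cw) = G (cw 0, cw 2) := by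
  obtain ⟨b, hbs, hbc, hbU, hb0, hb1⟩ := exists_ambientBump_ofReal ((((Circle.exp θ₀ : Circle) : ℂ)) • (1 : Matrix (Fin 2) (Fin 2) ℂ)) hU
  set f₀ : Matrix (Fin 2) (Fin 2) ℂ → ℂ := fun X => ((b X : ℝ) : ℂ) with hf₀
  have hf₀s : ContDiff ℝ ∞ f₀ := Complex.ofRealCLM.contDiff.comp hbs
  have hf₀c : HasCompactSupport f₀ := hbc.comp_left Complex.ofReal_zero
  have hsupp : tsupport f₀ ⊆ U := by
    refine (tsupport_comp_subset Complex.ofReal_zero b).trans hbU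
  have hre : ∀ X, 0 ≤ (f₀ X).re ∧ (f₀ X).im = 0 := fun X => ⟨by simp only [hf₀, Complex.ofReal_re]; exact hb0 X, by simp only [hf₀, Complex.ofReal_im]⟩
  have h1 : f₀ ((((Circle.exp θ₀ : Circle) : ℂ)) • 1) = 1 := by simp only [hf₀, hb1, Complex.ofReal_one]
  obtain ⟨Λ, hΛpos, hΛ⟩ := exists_splitReading_contDiff_even L w νw
  obtain ⟨G, hG, hGev, hG0, hGeq⟩ := hΛ f₀ hf₀s hf₀c
  refine ⟨f₀, G, hf₀s, hf₀c, hsupp, hre, h1, hG, hGev, ?_, hGeq⟩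
  rw [hG0]
  refine hΛpos θ₀ f₀ hf₀s.continuous hf₀c hre ⟨1, Subgroup.one_mem _, ?_⟩
  rw [OneMemClass.coe_one, Units.val_one, ← Circle.coe_exp, h1, Complex.one_re]
  exact one_pos

/-- **Angles near a centre, modulo `2π`**: if `e^{iθ}` is close to `e^{iθ₀}` then `θ` is congruent (same point of the circle) to some `θ'` close to `θ₀` (continuity of `arg` at `1`).
[cite: Rogawski1990, §8.2 p. 122] -/
theorem exists_circleExp_eq_abs_sub_lt (θ₀ : ℝ) {ε : ℝ} (hε : 0 < ε) :
    ∃ δ : ℝ, 0 < δ ∧ ∀ θ : ℝ, dist (Circle.exp θ) (Circle.exp θ₀) < δ → ∃ θ' : ℝ, Circle.exp θ' = Circle.exp θ ∧ |θ' - θ₀| < ε := by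
  have hc : ContinuousAt Complex.arg 1 := Complex.continuousAt_arg (Complex.mem_slitPlane_iff.2 (Or.inl (by norm_num)))
  obtain ⟨δ, hδ, hδε⟩ := Metric.continuousAt_iff.1 hc ε hε
  refine ⟨δ, hδ, fun θ hθ => ?_⟩
  refine ⟨θ₀ + Complex.arg (Circle.exp (θ - θ₀) : ℂ), ?_, ?_⟩
  · rw [Circle.exp_add, Circle.exp_arg, ← Circle.exp_add, add_sub_cancel]
  · rw [add_sub_cancel_left]
    have hd : dist ((Circle.exp (θ - θ₀) : Circle) : ℂ) 1 < δ := by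
      have hb : ((Circle.exp θ₀ : Circle) : ℂ) ≠ 0 := Circle.coe_ne_zero _
      have h1 : ((Circle.exp (θ - θ₀) : Circle) : ℂ) = (Circle.exp θ : ℂ) / (Circle.exp θ₀ : ℂ) := by rw [Circle.exp_sub, Circle.coe_div]
      rw [h1, dist_eq_norm, div_sub_one hb, norm_div, Circle.norm_coe, div_one]
      have hθ' : dist ((Circle.exp θ : Circle) : ℂ) ((Circle.exp θ₀ : Circle) : ℂ) < δ := hθ
      rwa [dist_eq_norm] at hθ'
    have := hδε hd
    rwa [Complex.arg_one, dist_zero_right, Real.norm_eq_abs] at this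

set_option maxHeartbeats 400000 in
/-- **(W3-G, COMPACT-TYPE GENERATOR) at the central block `z·1`, `z = e^{iθ₀}`**: inside any prescribed neighbourhood `U` of `z·1` there is an ambient `f₀ ∈ C_c^∞(M₂(ℂ))` with
`f₀(z·1) = 1` such that (G1-w) its SPLIT readings vanish identically near the wall — `chartOrbHLoc L S w ν_w (f₀ ∘ coe) cw = 0` for every label `S ∋ w` and every `cw` with
`0 < |cw 0| < δ`, `dist (e^{i cw 2}) z < δ` — and (G3-w) its COMPACT reading has Harish-Chandra's non-zero `∂_ψ`-limit at the wall: in the Cayley frame of `U(Φ₂)_w`,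
`∂_ψ[2 sin ψ · ∫_{U(Φ₂)_w} f₀(↑↑(h · P t_z(ψ) P⁻¹ · h⁻¹)) dν_w] → C · f₀(z·1) = C`, `C < 0` (★ (R1G) signed, ★ frame identity).  Construction: `f₀ = F¹ − (ρ ∘ tr)·F¹·κ`, `κ X = Σ |X_ij − (z·1)_ij|²`,
`ρ` the smooth class function of §1 realising the ratio of the two (even, smooth) split readings of ★ part 1; the vertex value is untouched because `κ(z·1) = 0`.
[cite: Varadarajan1989, §6.4 Thm 22, Thm 23] [cite: Rogawski1990, §8.2 Prop. 8.2.1 p. 119, p. 123] [cite: Shelstad1979, Lemma 4.3 p. 25] -/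
theorem exists_compactType_wallGenerator (θ₀ : ℝ) {U : Set (Matrix (Fin 2) (Fin 2) ℂ)} (hU : U ∈ 𝓝 ((((Circle.exp θ₀ : Circle) : ℂ)) • (1 : Matrix (Fin 2) (Fin 2) ℂ))) :
    ∃ (f₀ : Matrix (Fin 2) (Fin 2) ℂ → ℂ) (C δ : ℝ), ContDiff ℝ ∞ f₀ ∧ HasCompactSupport f₀ ∧ tsupport f₀ ⊆ U ∧
      f₀ ((((Circle.exp θ₀ : Circle) : ℂ)) • 1) = 1 ∧ C < 0 ∧ 0 < δ ∧
      (∀ S : Finset {w : InfinitePlace L // IsComplex w}, w ∈ S → ∀ cw : Fin 3 → ℝ, cw 0 ≠ 0 → |cw 0| < δ → dist (Circle.exp (cw 2)) (Circle.exp θ₀) < δ →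
        chartOrbHLoc L S w νw (fun g => f₀ ((g : GL (Fin 2) ℂ) : Matrix (Fin 2) (Fin 2) ℂ)) cw = 0) ∧
      Tendsto (fun ψ : ℝ => deriv (fun ψ : ℝ => (2 * Real.sin ψ) •
          ∫ h : ↥(archLocal L 2 (Matrix.of fun i j : Fin 2 => if i.val + j.val + 1 = 2 then (1 : L) else 0) w),
            f₀ (((h * ⟨Matrix.GeneralLinearGroup.mkOfDetNeZero !![(1 : ℂ), 1; 1, -1] det_cayleyTwo_ne_zero *
                  circleDiagonal 2 ![Circle.exp θ₀ * Circle.exp ψ, Circle.exp θ₀ * Circle.exp (-ψ)] *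
                  (Matrix.GeneralLinearGroup.mkOfDetNeZero !![(1 : ℂ), 1; 1, -1] det_cayleyTwo_ne_zero)⁻¹,
                cayley_conj_circleDiagonal_mem_archLocal L w _⟩ * h⁻¹ :
              ↥(archLocal L 2 (Matrix.of fun i j : Fin 2 => if i.val + j.val + 1 = 2 then (1 : L) else 0) w)) : GL (Fin 2) ℂ) : Matrix (Fin 2) (Fin 2) ℂ) ∂νw) ψ)
        (𝓝[≠] 0) (𝓝 ((C : ℝ) : ℂ)) := by
  haveI : Fact (0 < 2 * π) := ⟨Real.two_pi_pos⟩
  haveI := locallyCompactSpace_archLocal_two L w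
  haveI := secondCountableTopology_archLocal_two L w
  have hJ : ((Matrix.of fun i j : Fin 2 => if i.val + j.val + 1 = 2 then (1 : L) else 0).map w.1.embedding) = (StdForm.antidiagonal 2).over ℂ := by
    rw [Literature.NumberTheory.Rogawski1990.antidiagOne_map, StdForm.over_antidiagonal_eq]
  letI iG : MeasurableSpace ↥(unitaryGroupOfForm (starRingEnd ℂ) ((Matrix.of fun i j : Fin 2 => if i.val + j.val + 1 = 2 then (1 : L) else 0).map w.1.embedding)) := ‹MeasurableSpace ↥(archLocal L 2 (Matrix.of fun i j : Fin 2 => if i.val + j.val + 1 = 2 then (1 : L) else 0) w)›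
  haveI : BorelSpace ↥(unitaryGroupOfForm (starRingEnd ℂ) ((Matrix.of fun i j : Fin 2 => if i.val + j.val + 1 = 2 then (1 : L) else 0).map w.1.embedding)) := ‹BorelSpace ↥(archLocal L 2 (Matrix.of fun i j : Fin 2 => if i.val + j.val + 1 = 2 then (1 : L) else 0) w)›
  set z : ℂ := ((Circle.exp θ₀ : Circle) : ℂ) with hz
  have hzexp : z = Complex.exp ((θ₀ : ℂ) * Complex.I) := Circle.coe_exp θ₀
  -- the two bumps `F¹ = b`, `F² = b · κ`
  obtain ⟨b, hbs, hbc, hbU, hb0, hb1⟩ := exists_ambientBump_ofReal (z • (1 : Matrix (Fin 2) (Fin 2) ℂ)) hU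
  have hent : ∀ i j : Fin 2, ContDiff ℝ ∞ (fun X : Matrix (Fin 2) (Fin 2) ℂ => X i j) := fun i j =>
    ((Matrix.entryLinearMap ℝ ℂ i j).toContinuousLinearMap).contDiff
  have hnsq : ContDiff ℝ ∞ (fun t : ℂ => Complex.normSq t) := by
    have e : (fun t : ℂ => Complex.normSq t) = fun t => ‖t‖ ^ 2 := funext fun t => (Complex.sq_norm t).symm
    rw [e]; exact contDiff_norm_sq ℝ
  set κ : Matrix (Fin 2) (Fin 2) ℂ → ℝ := fun X => ∑ i, ∑ j, Complex.normSq (X i j - (z • (1 : Matrix (Fin 2) (Fin 2) ℂ)) i j) with hκ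
  have hκs : ContDiff ℝ ∞ κ := by
    refine ContDiff.sum fun i _ => ContDiff.sum fun j _ => hnsq.comp ((hent i j).sub contDiff_const)
  have hκ0 : ∀ X, 0 ≤ κ X := fun X => Finset.sum_nonneg fun i _ => Finset.sum_nonneg fun j _ => Complex.normSq_nonneg _
  have hκz : κ (z • (1 : Matrix (Fin 2) (Fin 2) ℂ)) = 0 := by
    simp only [hκ, sub_self, map_zero, Finset.sum_const_zero]
  set f₁ : Matrix (Fin 2) (Fin 2) ℂ → ℂ := fun X => ((b X : ℝ) : ℂ) with hf₁
  set f₂ : Matrix (Fin 2) (Fin 2) ℂ → ℂ := fun X => ((b X * κ X : ℝ) : ℂ) with hf₂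
  have hf₁s : ContDiff ℝ ∞ f₁ := Complex.ofRealCLM.contDiff.comp hbs
  have hf₂s : ContDiff ℝ ∞ f₂ := Complex.ofRealCLM.contDiff.comp (hbs.mul hκs)
  have hf₁c : HasCompactSupport f₁ := hbc.comp_left Complex.ofReal_zero
  have hf₂c : HasCompactSupport f₂ := (hbc.mul_right (f' := κ)).comp_left Complex.ofReal_zero
  have hre₂ : ∀ X, 0 ≤ (f₂ X).re ∧ (f₂ X).im = 0 := fun X => ⟨by simp only [hf₂, Complex.ofReal_re]; exact mul_nonneg (hb0 X) (hκ0 X), by simp only [hf₂, Complex.ofReal_im]⟩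
  -- ★ part 1: the cone functional and the two smooth even split readings
  obtain ⟨Λ, hΛpos, hΛ⟩ := exists_splitReading_contDiff_even L w νw
  obtain ⟨G₁, hG₁, hG₁ev, hG₁0, hG₁eq⟩ := hΛ f₁ hf₁s hf₁c
  obtain ⟨G₂, hG₂, hG₂ev, hG₂0, hG₂eq⟩ := hΛ f₂ hf₂s hf₂c
  -- `F²` is positive at ONE cone point `z · n₀`, `n₀ = ψ(u) ∈ N`, `u ≠ 0` small ⇒ `G₂ (0, θ₀) = Λ θ₀ f₂ ≠ 0`
  obtain ⟨ψ, hψc, hψadd, hψ01, -⟩ := exists_lineChart_real_isHaarMeasure_map hJ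
  have hψ0 : ψ 0 = 1 := by
    have h := hψadd 0 0
    rw [add_zero] at h
    exact left_eq_mul.mp h |>.symm ▸ rfl
  have hG₂ne : G₂ (0, θ₀) ≠ 0 := by
    rw [hG₂0]
    -- continuity of `u ↦ b (z • ↑↑(ψ u))` at `0`, value `1`
    have hinner₁ : Continuous fun u : ℝ => ((ψ u : ↥(unipotentU (starRingEnd ℂ) ((Matrix.of fun i j : Fin 2 => if i.val + j.val + 1 = 2 then (1 : L) else 0).map w.1.embedding))) : ↥(unitaryGroupOfForm (starRingEnd ℂ) ((Matrix.of fun i j : Fin 2 => if i.val + j.val + 1 = 2 then (1 : L) else 0).map w.1.embedding))) :=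
      continuous_subtype_val.comp hψc
    have hinner₂ : Continuous fun u : ℝ => (((ψ u : ↥(unipotentU (starRingEnd ℂ) ((Matrix.of fun i j : Fin 2 => if i.val + j.val + 1 = 2 then (1 : L) else 0).map w.1.embedding))) : ↥(unitaryGroupOfForm (starRingEnd ℂ) ((Matrix.of fun i j : Fin 2 => if i.val + j.val + 1 = 2 then (1 : L) else 0).map w.1.embedding))) : GL (Fin 2) ℂ) :=
      continuous_subtype_val.comp hinner₁
    have hinner : Continuous fun u : ℝ => ((((ψ u : ↥(unipotentU (starRingEnd ℂ) ((Matrix.of fun i j : Fin 2 => if i.val + j.val + 1 = 2 then (1 : L) else 0).map w.1.embedding))) : ↥(unitaryGroupOfForm (starRingEnd ℂ) ((Matrix.of fun i j : Fin 2 => if i.val + j.val + 1 = 2 then (1 : L) else 0).map w.1.embedding))) : GL (Fin 2) ℂ) : Matrix (Fin 2) (Fin 2) ℂ) :=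
      Units.continuous_val.comp hinner₂
    have hcont : Continuous fun u : ℝ => b (z • ((((ψ u : ↥(unipotentU (starRingEnd ℂ) ((Matrix.of fun i j : Fin 2 => if i.val + j.val + 1 = 2 then (1 : L) else 0).map w.1.embedding))) : ↥(unitaryGroupOfForm (starRingEnd ℂ) ((Matrix.of fun i j : Fin 2 => if i.val + j.val + 1 = 2 then (1 : L) else 0).map w.1.embedding))) : GL (Fin 2) ℂ) : Matrix (Fin 2) (Fin 2) ℂ)) :=
      hbs.continuous.comp ((continuous_const_smul z).comp hinner)
    have hval : b (z • ((((ψ 0 : ↥(unipotentU (starRingEnd ℂ) ((Matrix.of fun i j : Fin 2 => if i.val + j.val + 1 = 2 then (1 : L) else 0).map w.1.embedding))) : ↥(unitaryGroupOfForm (starRingEnd ℂ) ((Matrix.of fun i j : Fin 2 => if i.val + j.val + 1 = 2 then (1 : L) else 0).map w.1.embedding))) : GL (Fin 2) ℂ) : Matrix (Fin 2) (Fin 2) ℂ)) = 1 := by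
      rw [hψ0, OneMemClass.coe_one, OneMemClass.coe_one, Units.val_one, hb1]
    have hev : ∀ᶠ u : ℝ in 𝓝 0, 1 / 2 < b (z • ((((ψ u : ↥(unipotentU (starRingEnd ℂ) ((Matrix.of fun i j : Fin 2 => if i.val + j.val + 1 = 2 then (1 : L) else 0).map w.1.embedding))) : ↥(unitaryGroupOfForm (starRingEnd ℂ) ((Matrix.of fun i j : Fin 2 => if i.val + j.val + 1 = 2 then (1 : L) else 0).map w.1.embedding))) : GL (Fin 2) ℂ) : Matrix (Fin 2) (Fin 2) ℂ)) :=
      hcont.continuousAt.eventually (lt_mem_nhds (by simp only [hval]; norm_num))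
    obtain ⟨ε₁, hε₁, hε₁b⟩ := Metric.eventually_nhds_iff.1 hev
    set u : ℝ := ε₁ / 2 with hu
    have hu0 : u ≠ 0 := by positivity
    have hub : 1 / 2 < b (z • ((((ψ u : ↥(unipotentU (starRingEnd ℂ) ((Matrix.of fun i j : Fin 2 => if i.val + j.val + 1 = 2 then (1 : L) else 0).map w.1.embedding))) : ↥(unitaryGroupOfForm (starRingEnd ℂ) ((Matrix.of fun i j : Fin 2 => if i.val + j.val + 1 = 2 then (1 : L) else 0).map w.1.embedding))) : GL (Fin 2) ℂ) : Matrix (Fin 2) (Fin 2) ℂ)) :=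
      hε₁b (by rw [dist_zero_right, Real.norm_eq_abs, hu, abs_of_pos (by positivity)]; linarith)
    refine hΛpos θ₀ f₂ hf₂s.continuous hf₂c hre₂ ⟨((ψ u : ↥(unipotentU (starRingEnd ℂ) ((Matrix.of fun i j : Fin 2 => if i.val + j.val + 1 = 2 then (1 : L) else 0).map w.1.embedding))) : ↥(unitaryGroupOfForm (starRingEnd ℂ) ((Matrix.of fun i j : Fin 2 => if i.val + j.val + 1 = 2 then (1 : L) else 0).map w.1.embedding))), (ψ u).2, ?_⟩
    rw [← hzexp]
    simp only [hf₂, Complex.ofReal_re]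
    refine mul_pos (by linarith) ?_
    -- `κ > 0` at `z · ψ(u)`: the `(0,1)` entry is `z · u · I ≠ 0`
    have h01 : (z • ((((ψ u : ↥(unipotentU (starRingEnd ℂ) ((Matrix.of fun i j : Fin 2 => if i.val + j.val + 1 = 2 then (1 : L) else 0).map w.1.embedding))) : ↥(unitaryGroupOfForm (starRingEnd ℂ) ((Matrix.of fun i j : Fin 2 => if i.val + j.val + 1 = 2 then (1 : L) else 0).map w.1.embedding))) : GL (Fin 2) ℂ) : Matrix (Fin 2) (Fin 2) ℂ)) 0 1 -
        (z • (1 : Matrix (Fin 2) (Fin 2) ℂ)) 0 1 = z * ((u : ℂ) * Complex.I) := by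
      rw [Matrix.smul_apply, Matrix.smul_apply, hψ01 u, Matrix.one_apply_ne (by decide), smul_zero, sub_zero, smul_eq_mul]
    have hpos01 : 0 < Complex.normSq (z * ((u : ℂ) * Complex.I)) := by
      rw [Complex.normSq_pos]
      exact mul_ne_zero (Circle.coe_ne_zero _) (mul_ne_zero (Complex.ofReal_ne_zero.2 hu0) Complex.I_ne_zero)
    calc (0 : ℝ) < Complex.normSq (z * ((u : ℂ) * Complex.I)) := hpos01
      _ = Complex.normSq ((z • ((((ψ u : ↥(unipotentU (starRingEnd ℂ) ((Matrix.of fun i j : Fin 2 => if i.val + j.val + 1 = 2 then (1 : L) else 0).map w.1.embedding))) : ↥(unitaryGroupOfForm (starRingEnd ℂ) ((Matrix.of fun i j : Fin 2 => if i.val + j.val + 1 = 2 then (1 : L) else 0).map w.1.embedding))) : GL (Fin 2) ℂ) : Matrix (Fin 2) (Fin 2) ℂ)) 0 1 -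
            (z • (1 : Matrix (Fin 2) (Fin 2) ℂ)) 0 1) := by rw [h01]
      _ ≤ ∑ j, Complex.normSq ((z • ((((ψ u : ↥(unipotentU (starRingEnd ℂ) ((Matrix.of fun i j : Fin 2 => if i.val + j.val + 1 = 2 then (1 : L) else 0).map w.1.embedding))) : ↥(unitaryGroupOfForm (starRingEnd ℂ) ((Matrix.of fun i j : Fin 2 => if i.val + j.val + 1 = 2 then (1 : L) else 0).map w.1.embedding))) : GL (Fin 2) ℂ) : Matrix (Fin 2) (Fin 2) ℂ)) 0 j -
            (z • (1 : Matrix (Fin 2) (Fin 2) ℂ)) 0 j) :=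
          Finset.single_le_sum (f := fun j => Complex.normSq ((z • ((((ψ u : ↥(unipotentU (starRingEnd ℂ) ((Matrix.of fun i j : Fin 2 => if i.val + j.val + 1 = 2 then (1 : L) else 0).map w.1.embedding))) : ↥(unitaryGroupOfForm (starRingEnd ℂ) ((Matrix.of fun i j : Fin 2 => if i.val + j.val + 1 = 2 then (1 : L) else 0).map w.1.embedding))) : GL (Fin 2) ℂ) : Matrix (Fin 2) (Fin 2) ℂ)) 0 j -
            (z • (1 : Matrix (Fin 2) (Fin 2) ℂ)) 0 j)) (fun j _ => Complex.normSq_nonneg _) (Finset.mem_univ (1 : Fin 2))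
      _ ≤ κ (z • ((((ψ u : ↥(unipotentU (starRingEnd ℂ) ((Matrix.of fun i j : Fin 2 => if i.val + j.val + 1 = 2 then (1 : L) else 0).map w.1.embedding))) : ↥(unitaryGroupOfForm (starRingEnd ℂ) ((Matrix.of fun i j : Fin 2 => if i.val + j.val + 1 = 2 then (1 : L) else 0).map w.1.embedding))) : GL (Fin 2) ℂ) : Matrix (Fin 2) (Fin 2) ℂ)) :=
          Finset.single_le_sum (f := fun i => ∑ j, Complex.normSq ((z • ((((ψ u : ↥(unipotentU (starRingEnd ℂ) ((Matrix.of fun i j : Fin 2 => if i.val + j.val + 1 = 2 then (1 : L) else 0).map w.1.embedding))) : ↥(unitaryGroupOfForm (starRingEnd ℂ) ((Matrix.of fun i j : Fin 2 => if i.val + j.val + 1 = 2 then (1 : L) else 0).map w.1.embedding))) : GL (Fin 2) ℂ) : Matrix (Fin 2) (Fin 2) ℂ)) i j -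
            (z • (1 : Matrix (Fin 2) (Fin 2) ℂ)) i j)) (fun i _ => Finset.sum_nonneg fun j _ => Complex.normSq_nonneg _) (Finset.mem_univ (0 : Fin 2))
  -- §1: the class function `ρ` with `ρ (2 cosh x · e^{iθ}) · G₂ = G₁` near `(0, θ₀)`
  obtain ⟨ρ, hρ, δ₁, hδ₁, hρeq⟩ := exists_contDiff_comp_trace_mul_eq_of_even hG₁ hG₂ hG₁ev hG₂ev θ₀ hG₂ne
  -- the compact-type generator
  have htr : ContDiff ℝ ∞ (fun X : Matrix (Fin 2) (Fin 2) ℂ => Matrix.trace X) := by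
    have e : (fun X : Matrix (Fin 2) (Fin 2) ℂ => Matrix.trace X) = fun X => X 0 0 + X 1 1 := funext fun X => Matrix.trace_fin_two X
    rw [e]; exact (hent 0 0).add (hent 1 1)
  set f₀ : Matrix (Fin 2) (Fin 2) ℂ → ℂ := fun X => f₁ X - ρ (Matrix.trace X) * f₂ X with hf₀
  have hf₀s : ContDiff ℝ ∞ f₀ := hf₁s.sub ((hρ.comp htr).mul hf₂s)
  have hf₀c : HasCompactSupport f₀ := hf₁c.sub (hf₂c.mul_left (f := fun X => ρ (Matrix.trace X)))
  have hf₀U : tsupport f₀ ⊆ U := by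
    refine (closure_mono ?_).trans hbU
    intro X hX
    rw [Function.mem_support] at hX ⊢
    intro hbX
    apply hX
    simp only [hf₀, hf₁, hf₂, hbX, Complex.ofReal_zero, zero_mul, mul_zero, sub_zero]
  have hf₀z : f₀ (z • 1) = 1 := by
    simp only [hf₀, hf₁, hf₂, hb1, hκz, mul_zero, Complex.ofReal_zero, Complex.ofReal_one, mul_zero, sub_zero]
  -- (G3-w): Harish-Chandra's limit formula in the diagonal frame, transported to the Cayley frame
  obtain ⟨e, hHaar, hRinv, hkey⟩ := exists_two_sin_smul_orbitalIntegral_cayley_eq (E := ℂ) L w νw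
  letI iD : MeasurableSpace ↥(unitaryGroupOfForm (starRingEnd ℂ) ((Matrix.diagonal ![(2 : L), -2]).map w.1.embedding)) := borel _
  haveI : BorelSpace ↥(unitaryGroupOfForm (starRingEnd ℂ) ((Matrix.diagonal ![(2 : L), -2]).map w.1.embedding)) := ⟨rfl⟩
  haveI : (νw.map e.symm).IsHaarMeasure := hHaar
  have hreal : ∀ i, (w.1.embedding (![(2 : L), -2] i)).im = 0 := by
    intro i; fin_cases i
    · show (w.1.embedding 2).im = 0
      rw [map_ofNat]; norm_num
    · show (w.1.embedding (-2)).im = 0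
      rw [map_neg, map_ofNat]; norm_num
  have hsgn : (w.1.embedding (![(2 : L), -2] 0)).re * (w.1.embedding (![(2 : L), -2] 1)).re < 0 := by
    show (w.1.embedding 2).re * (w.1.embedding (-2)).re < 0
    rw [map_neg, map_ofNat]; norm_num
  obtain ⟨C, hC, hlim⟩ := exists_tendsto_deriv_two_sin_smul_orbitalIntegral_neg (E := ℂ) w.1.embedding ![(2 : L), -2] hreal hsgn (νw.map e.symm)
  -- the transported test function `X ↦ f₀ (P X P⁻¹)` is `C¹` with compact support and takes the value `1` at the centre
  set g : Matrix (Fin 2) (Fin 2) ℂ → ℂ := fun X => f₀ ((!![(1 : ℂ), 1; 1, -1] : Matrix (Fin 2) (Fin 2) ℂ) * X * !![(1 / 2 : ℂ), 1 / 2; 1 / 2, -(1 / 2)]) with hg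
  have hPP : ((!![(1 : ℂ), 1; 1, -1] : Matrix (Fin 2) (Fin 2) ℂ) * !![(1 / 2 : ℂ), 1 / 2; 1 / 2, -(1 / 2)]) = 1 := by
    rw [Matrix.mul_fin_two, Matrix.one_fin_two]; norm_num
  have hP'P : ((!![(1 / 2 : ℂ), 1 / 2; 1 / 2, -(1 / 2)] : Matrix (Fin 2) (Fin 2) ℂ) * !![(1 : ℂ), 1; 1, -1]) = 1 := by
    rw [Matrix.mul_fin_two, Matrix.one_fin_two]; norm_num
  have hφc : ContDiff ℝ ∞ fun X : Matrix (Fin 2) (Fin 2) ℂ => ((!![(1 : ℂ), 1; 1, -1] : Matrix (Fin 2) (Fin 2) ℂ) * X * !![(1 / 2 : ℂ), 1 / 2; 1 / 2, -(1 / 2)]) :=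
    (contDiff_const.mul contDiff_id).mul contDiff_const
  have hg1 : ContDiff ℝ 1 g := (hf₀s.comp hφc).of_le (by exact_mod_cast le_top)
  have hgc : HasCompactSupport g := by
    let φ : Matrix (Fin 2) (Fin 2) ℂ ≃ₜ Matrix (Fin 2) (Fin 2) ℂ :=
      { toFun := fun X => ((!![(1 : ℂ), 1; 1, -1] : Matrix (Fin 2) (Fin 2) ℂ) * X * !![(1 / 2 : ℂ), 1 / 2; 1 / 2, -(1 / 2)])
        invFun := fun X => ((!![(1 / 2 : ℂ), 1 / 2; 1 / 2, -(1 / 2)] : Matrix (Fin 2) (Fin 2) ℂ) * X * !![(1 : ℂ), 1; 1, -1])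
        left_inv := fun X => by
          show !![(1 / 2 : ℂ), 1 / 2; 1 / 2, -(1 / 2)] * (!![(1 : ℂ), 1; 1, -1] * X * !![(1 / 2 : ℂ), 1 / 2; 1 / 2, -(1 / 2)]) * !![(1 : ℂ), 1; 1, -1] = X
          rw [← Matrix.mul_assoc, ← Matrix.mul_assoc, hP'P, Matrix.one_mul, Matrix.mul_assoc, hP'P, Matrix.mul_one]
        right_inv := fun X => by
          show !![(1 : ℂ), 1; 1, -1] * (!![(1 / 2 : ℂ), 1 / 2; 1 / 2, -(1 / 2)] * X * !![(1 : ℂ), 1; 1, -1]) * !![(1 / 2 : ℂ), 1 / 2; 1 / 2, -(1 / 2)] = X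
          rw [← Matrix.mul_assoc, ← Matrix.mul_assoc, hPP, Matrix.one_mul, Matrix.mul_assoc, hPP, Matrix.mul_one]
        continuous_toFun := (continuous_const.mul continuous_id).mul continuous_const
        continuous_invFun := (continuous_const.mul continuous_id).mul continuous_const }
    exact hf₀c.comp_homeomorph φ
  have hgz : g (z • 1) = 1 := by
    simp only [hg, Matrix.mul_smul, Matrix.mul_one, Matrix.smul_mul, hPP]
    exact hf₀z
  have hlimg := (hlim g hg1 hgc (Circle.exp θ₀)).1
  -- §3: assemble
  obtain ⟨δ₂, hδ₂, hang⟩ := exists_circleExp_eq_abs_sub_lt θ₀ hδ₁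
  refine ⟨f₀, C, min δ₁ δ₂, hf₀s, hf₀c, hf₀U, hf₀z, hC, lt_min hδ₁ hδ₂, fun S hw cw hx hxδ hθδ => ?_, ?_⟩
  · -- (G1-w)
    obtain ⟨θ', hθ', hθ'δ⟩ := hang (cw 2) (lt_of_lt_of_le hθδ (min_le_right _ _))
    have hxδ₁ : |cw 0| < δ₁ := lt_of_lt_of_le hxδ (min_le_left _ _)
    -- move the angle slot to the representative `θ'` (same chart point)
    have hpt : endoBlockAt L S w cw = endoBlockAt L S w ![cw 0, cw 1, θ'] := by
      rw [endoBlockAt_eq_mk_hypBlockGL L S hw cw, endoBlockAt_eq_mk_hypBlockGL L S hw]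
      apply Subtype.ext
      simp only [Matrix.cons_val_zero, Matrix.cons_val_two, Matrix.tail_cons, Matrix.head_cons]
      have h' : Complex.exp ((θ' : ℂ) * I) = Complex.exp (((cw 2 : ℝ) : ℂ) * I) := by
        have h1 := congrArg (fun u : Circle => (u : ℂ)) hθ'
        simpa only [Circle.coe_exp] using h1
      apply Units.ext
      rw [coe_hypBlockGL, coe_hypBlockGL]
      simp only [Complex.exp_add, h']
    rw [chartOrbHLoc_congr L S w νw _ hpt]
    have hne : (((|Real.exp (cw 0) - Real.exp (-(cw 0))| : ℝ) : ℂ)) ≠ 0 := by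
      rw [Complex.ofReal_ne_zero, abs_ne_zero, sub_ne_zero]
      exact fun h => hx (by have := Real.exp_injective h; linarith)
    have hsplit := chartOrbHLoc_sub_traceMul_eq L S νw hw (cw := ![cw 0, cw 1, θ']) (by simpa using hx) hf₁s.continuous hf₁c hf₂s.continuous hf₂c ρ
    obtain ⟨hG₂x, hρx⟩ := hρeq (cw 0) θ' hxδ₁ hθ'δ
    have h1 := hG₁eq S hw ![cw 0, cw 1, θ'] (by simpa using hx)
    have h2 := hG₂eq S hw ![cw 0, cw 1, θ'] (by simpa using hx)
    simp only [Matrix.cons_val_zero, Matrix.cons_val_two, Matrix.tail_cons, Matrix.head_cons] at h1 h2 hsplit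
    apply (mul_right_injective₀ hne)
    show (((|Real.exp (cw 0) - Real.exp (-(cw 0))| : ℝ) : ℂ)) * chartOrbHLoc L S w νw (fun k => f₀ ((k : GL (Fin 2) ℂ) : Matrix (Fin 2) (Fin 2) ℂ)) ![cw 0, cw 1, θ'] =
      (((|Real.exp (cw 0) - Real.exp (-(cw 0))| : ℝ) : ℂ)) * 0
    rw [mul_zero, show (fun k : ↥(archLocal L 2 (Matrix.of fun i j : Fin 2 => if i.val + j.val + 1 = 2 then (1 : L) else 0) w) => f₀ ((k : GL (Fin 2) ℂ) : Matrix (Fin 2) (Fin 2) ℂ)) =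
      fun k : ↥(archLocal L 2 (Matrix.of fun i j : Fin 2 => if i.val + j.val + 1 = 2 then (1 : L) else 0) w) => f₁ ((k : GL (Fin 2) ℂ) : Matrix (Fin 2) (Fin 2) ℂ) - ρ (Matrix.trace ((k : GL (Fin 2) ℂ) : Matrix (Fin 2) (Fin 2) ℂ)) * f₂ ((k : GL (Fin 2) ℂ) : Matrix (Fin 2) (Fin 2) ℂ) from rfl,
      hsplit, mul_sub, h1, mul_left_comm, h2, ← hρx]
    ring
  · -- (G3-w): the Cayley-frame functional IS the diagonal-frame functional of `g`
    have hfun : (fun ψ : ℝ => (2 * Real.sin ψ) •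
          ∫ h : ↥(archLocal L 2 (Matrix.of fun i j : Fin 2 => if i.val + j.val + 1 = 2 then (1 : L) else 0) w),
            f₀ (((h * ⟨Matrix.GeneralLinearGroup.mkOfDetNeZero !![(1 : ℂ), 1; 1, -1] det_cayleyTwo_ne_zero *
                  circleDiagonal 2 ![Circle.exp θ₀ * Circle.exp ψ, Circle.exp θ₀ * Circle.exp (-ψ)] *
                  (Matrix.GeneralLinearGroup.mkOfDetNeZero !![(1 : ℂ), 1; 1, -1] det_cayleyTwo_ne_zero)⁻¹,
                cayley_conj_circleDiagonal_mem_archLocal L w _⟩ * h⁻¹ :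
              ↥(archLocal L 2 (Matrix.of fun i j : Fin 2 => if i.val + j.val + 1 = 2 then (1 : L) else 0) w)) : GL (Fin 2) ℂ) : Matrix (Fin 2) (Fin 2) ℂ) ∂νw) =
        (fun ψ : ℝ => (2 * Real.sin ψ) • ∫ h' : ↥(unitaryGroupOfForm (starRingEnd ℂ) ((Matrix.diagonal ![(2 : L), -2]).map w.1.embedding)),
            g (((h' * ⟨circleDiagonal 2 ![Circle.exp θ₀ * Circle.exp ψ, Circle.exp θ₀ * Circle.exp (-ψ)],
                circleDiagonal_mem_archLocal_diagonal L 2 ![(2 : L), -2] w _⟩ * h'⁻¹ :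
              ↥(unitaryGroupOfForm (starRingEnd ℂ) ((Matrix.diagonal ![(2 : L), -2]).map w.1.embedding))) : GL (Fin 2) ℂ) : Matrix (Fin 2) (Fin 2) ℂ) ∂(νw.map e.symm)) := by
      funext ψ
      rw [hkey f₀ (Circle.exp θ₀) ψ]
    rw [hfun]
    have hval : C • g ((((Circle.exp θ₀ : Circle) : ℂ)) • (1 : Matrix (Fin 2) (Fin 2) ℂ)) = ((C : ℝ) : ℂ) := by
      rw [← hz, hgz, Complex.real_smul, mul_one]
    rw [← hval]
    exact hlimg

end Generators

end Literature.NumberTheory.Rogawski1990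

end
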